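import Summits.QuantumFields.BalabanUV.Beta.GAN24.DerivativeRateTransferJensenChain

/-!
# `BalabanUV.Beta.GAN24.DerivativeRateTransferJensenIntertwine` — binder row G-an2-4 ∕ (CONV-C), route R6 «VALUES, NOT DERIVATIVES», PART 28:
# THE INTERTWINING FORM OF THE COVARIANT JENSEN INEQUALITY — whenever a coarse «derivative» of the averaged field is a transported sub-stochastic
# mean of fine «derivatives» plus a defect, `D′(Qu) = Σ q·W·(Du) + E(u)`, the coarse energy is bounded by `(1+t)·m·` fine energy `+ (1+t⁻¹)·|E(u)|²`;
# the template the vector-field ∕ plaquette case of (STAB) needs («(sites, bonds) ↦ (bonds, plaquettes)», ROUTES-GAN24 v39 R6 NOTE)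
# (unit b2b-balaban-gan24-p3, gen 37; v1)

NOT IN PRINT; OUR PROOF (for the ROUTE; [folklore] — PART 21's weighted Jensen `dotProduct_self_wsum_le` and Peter–Paul `dotProduct_self_add_le` BY NAME,
one `Finset.sum_comm`).  HONEST FRAMING (cell contract, verbatim): «discharging `BetaPertH` makes Bałaban's UV stability UNCONDITIONAL — a real
constructive-QFT result; it is NOT the continuum limit and NOT the Clay problem.»  HONEST DEPENDENCY (verbatim): «continuum YM on T⁴ ⇐ BetaPertH ∧ nine
spine estimates (0/9 proved); BetaPertH ⇐ (D1) ∧ (D4) ∧ CAP+tail; G-an2-4 gates asym, D1 and NE2/3/4.»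

WHY THIS FILE.  PART 22 proves (STAB) for colour SITE fields, where the «derivative» is a covariant bond difference and the intertwining identity
(`coarseDiff_avg_eq` + the chain telescoping) is proved inside the file.  For Bałaban's VECTOR fields the energy has a CURL part (plaquettes): the
averaging (1.18) intertwines the covariant exterior derivative with a transported PLAQUETTE averaging up to holonomy defects — an identity the consumer
must supply for his `d_U`, `Q(U)` (at `U = 1` it is road P4's `MonotoneTorusPlaquette` bookkeeping).  THIS FILE isolates what the Jensen step needs from
such an identity and nothing else: the cells `P` (fine) and `P′` (coarse) are abstract, the «derivatives» `D`, `D′` are arbitrary maps into colour vectors,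
the defect `E` is arbitrary with a mass bound.  PART 22's site case and the future plaquette case are both instances.

WHAT THIS FILE PROVES (0 sorry, 0 `def`, nothing cited):
* §1 **`intertwine_sum_le`** — cellwise: `G p′ = Σ_p q(p′,p)·W(p′,p)(F p) + E p′` with `q ≥ 0`, `Σ_p q(p′,p) ≤ 1`, `W` orthogonal, column sums
  `Σ_{p′} q(p′,p) ≤ m` ⟹ `Σ_{p′}|G p′|² ≤ (1+t)·m·Σ_p|F p|² + (1+t⁻¹)·Σ_{p′}|E p′|²` (every `t > 0`); **`intertwine_sum_le_exact`** (`E = 0`: `≤ m·Σ_p|F p|²`).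
* §2 **`intertwine_jensen`** — the form level: `⟨v,H_cv⟩ ≤ w_c·Σ_{p′}|D′v p′|²`, `w_f·Σ_p|Du p|² ≤ ⟨u,H_fu⟩`, the intertwining identity for `v = Qu`,
  `Σ_{p′}|Eu p′|² ≤ K·|u|²`, `w_c·m ≤ w_f` ⟹ `⟨Qu,H_cQu⟩ ≤ (1+t)⟨u,H_fu⟩ + (1+t⁻¹)·w_c·K·|u|²`; **`intertwine_jensen_exact`** (no defect: `≤ ⟨u,H_fu⟩`);
  **`posSemidef_intertwine_jensen`** ∕ **`posSemidef_intertwine_jensen_exact`** (PART 20's (STAB-ε,δ) with `G = 1` ∕ PART 18's (STAB)).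
WHAT IT DOES NOT DO: supply the intertwining identity for any operator (PART 22 does it for site fields; the plaquette case is the consumer's ∕ S2(ii)).
SUPPLIER work on route R6 (rank 2, REDUCTION, no seat); no consumer of record; NEVER «G-an2-4 closed»; NOT (CONV-C), NOT D1, NOT `BetaPertH`, NOT
continuum, NOT Clay.  Records: `HOME/b2b-balaban-gan24-p3/WOODBURY-FIBRE.md` v13.7.
-/

noncomputable section

open Matrix Finset

namespace Summit.QuantumFields.BalabanUV.Beta.GAN24.DerivativeRateTransferJensenIntertwine

open Summit.QuantumFields.BalabanUV.Beta.GAN24.DerivativeRateTransferLoewnerKKT (mulVec_dotProduct_eq)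
open Summit.QuantumFields.BalabanUV.Beta.GAN24.DerivativeRateTransferJensenChain

variable {o P P' : Type*} [Fintype o] [DecidableEq o] [Fintype P] [Fintype P']

/-! ## §1 Cellwise: transported sub-stochastic means plus a defect -/

section Cells

/-- **`intertwine_sum_le` — JENSEN ACROSS AN INTERTWINING IDENTITY WITH DEFECT** [our proof]: `G p′ = Σ_p q(p′,p)·W(p′,p)(F p) + E p′` with weights
`q ≥ 0`, `Σ_p q(p′,p) ≤ 1`, orthogonal `W`, column sums `Σ_{p′} q(p′,p) ≤ m`, and `t > 0` ⟹
`Σ_{p′}|G p′|² ≤ (1+t)·(m·Σ_p|F p|²) + (1+t⁻¹)·Σ_{p′}|E p′|²`. -/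
theorem intertwine_sum_le (q : P' → P → ℝ) (hq : ∀ p' p, 0 ≤ q p' p) (hq1 : ∀ p', ∑ p, q p' p ≤ 1)
    (W : P' → P → Matrix o o ℝ) (hW : ∀ p' p, (W p' p)ᵀ * W p' p = 1) {m : ℝ} (hmult : ∀ p, ∑ p', q p' p ≤ m)
    (F : P → o → ℝ) (G E : P' → o → ℝ) (hint : ∀ p', G p' = ∑ p, q p' p • (W p' p *ᵥ F p) + E p') {t : ℝ} (ht : 0 < t) :
    ∑ p', G p' ⬝ᵥ G p' ≤ (1 + t) * (m * ∑ p, F p ⬝ᵥ F p) + (1 + t⁻¹) * ∑ p', E p' ⬝ᵥ E p' := by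
  have hper : ∀ p', G p' ⬝ᵥ G p' ≤ (1 + t) * ∑ p, q p' p * (F p ⬝ᵥ F p) + (1 + t⁻¹) * (E p' ⬝ᵥ E p') := fun p' => by
    rw [hint p']
    refine (dotProduct_self_add_le _ _ ht).trans (add_le_add ?_ le_rfl)
    exact mul_le_mul_of_nonneg_left (dotProduct_self_wsum_le Finset.univ (fun p _ => hq p' p) (hq1 p') (fun p _ => hW p' p) F)
      (by linarith)
  refine (Finset.sum_le_sum fun p' _ => hper p').trans ?_
  rw [Finset.sum_add_distrib, ← Finset.mul_sum, ← Finset.mul_sum, Finset.sum_comm]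
  refine add_le_add (mul_le_mul_of_nonneg_left ?_ (by linarith)) le_rfl
  rw [Finset.mul_sum]
  refine Finset.sum_le_sum fun p _ => ?_
  rw [← Finset.sum_mul]
  exact mul_le_mul_of_nonneg_right (hmult p) (dotProduct_self_nonneg' _)

/-- **`intertwine_sum_le_exact` — NO DEFECT** (`G p′ = Σ_p q·W·F p`): `Σ_{p′}|G p′|² ≤ m·Σ_p|F p|²`. [our proof] -/
theorem intertwine_sum_le_exact (q : P' → P → ℝ) (hq : ∀ p' p, 0 ≤ q p' p) (hq1 : ∀ p', ∑ p, q p' p ≤ 1)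
    (W : P' → P → Matrix o o ℝ) (hW : ∀ p' p, (W p' p)ᵀ * W p' p = 1) {m : ℝ} (hmult : ∀ p, ∑ p', q p' p ≤ m)
    (F : P → o → ℝ) (G : P' → o → ℝ) (hint : ∀ p', G p' = ∑ p, q p' p • (W p' p *ᵥ F p)) :
    ∑ p', G p' ⬝ᵥ G p' ≤ m * ∑ p, F p ⬝ᵥ F p := by
  have hper : ∀ p', G p' ⬝ᵥ G p' ≤ ∑ p, q p' p * (F p ⬝ᵥ F p) := fun p' => by
    rw [hint p']
    exact dotProduct_self_wsum_le Finset.univ (fun p _ => hq p' p) (hq1 p') (fun p _ => hW p' p) F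
  refine (Finset.sum_le_sum fun p' _ => hper p').trans ?_
  rw [Finset.sum_comm, Finset.mul_sum]
  refine Finset.sum_le_sum fun p _ => ?_
  rw [← Finset.sum_mul]
  exact mul_le_mul_of_nonneg_right (hmult p) (dotProduct_self_nonneg' _)

end Cells

/-! ## §2 The form level: (STAB-ε,δ) ∕ (STAB) from an intertwining identity -/

section Forms

variable {X Y : Type*} [Fintype X] [Fintype Y]
variable {q : P' → P → ℝ} {W : P' → P → Matrix o o ℝ} {m wf wc K : ℝ}
variable {D : (X → ℝ) → P → o → ℝ} {D' : (Y → ℝ) → P' → o → ℝ} {Eu : (X → ℝ) → P' → o → ℝ}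
variable {Q : Matrix Y X ℝ} {Hf : Matrix X X ℝ} {Hc : Matrix Y Y ℝ}

/-- **`intertwine_jensen` — (STAB-ε,δ) FROM AN INTERTWINING IDENTITY WITH A MASS-BOUNDED DEFECT** [our proof]: fine «derivatives» `Du p`, coarse ones
`D′v p′`, the identity `D′(Qu) p′ = Σ_p q(p′,p)·W(p′,p)(Du p) + Eu p′` (sub-stochastic `q`, orthogonal `W`, column sums `≤ m`), forms with
`w_f·Σ_p|Du p|² ≤ ⟨u,H_fu⟩` and `⟨v,H_cv⟩ ≤ w_c·Σ_{p′}|D′v p′|²`, defect mass `Σ_{p′}|Eu p′|² ≤ K·|u|²`, weights `w_c·m ≤ w_f` (`0 ≤ w_c`), `t > 0` ⟹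
`⟨Qu, H_cQu⟩ ≤ (1+t)·⟨u, H_fu⟩ + (1+t⁻¹)·w_c·K·|u|²`. -/
theorem intertwine_jensen (hq : ∀ p' p, 0 ≤ q p' p) (hq1 : ∀ p', ∑ p, q p' p ≤ 1) (hW : ∀ p' p, (W p' p)ᵀ * W p' p = 1)
    (hmult : ∀ p, ∑ p', q p' p ≤ m) (hwc : 0 ≤ wc) (hw : wc * m ≤ wf)
    (hHf : ∀ u : X → ℝ, wf * ∑ p, D u p ⬝ᵥ D u p ≤ u ⬝ᵥ (Hf *ᵥ u))
    (hHc : ∀ v : Y → ℝ, v ⬝ᵥ (Hc *ᵥ v) ≤ wc * ∑ p', D' v p' ⬝ᵥ D' v p')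
    (hint : ∀ (u : X → ℝ) p', D' (Q *ᵥ u) p' = ∑ p, q p' p • (W p' p *ᵥ D u p) + Eu u p')
    (hE : ∀ u : X → ℝ, ∑ p', Eu u p' ⬝ᵥ Eu u p' ≤ K * (u ⬝ᵥ u)) {t : ℝ} (ht : 0 < t) (u : X → ℝ) :
    (Q *ᵥ u) ⬝ᵥ (Hc *ᵥ (Q *ᵥ u)) ≤ (1 + t) * (u ⬝ᵥ (Hf *ᵥ u)) + (1 + t⁻¹) * wc * K * (u ⬝ᵥ u) := by
  have h := intertwine_sum_le q hq hq1 W hW hmult (D u) (D' (Q *ᵥ u)) (Eu u) (hint u) ht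
  have hF0 : 0 ≤ ∑ p, D u p ⬝ᵥ D u p := Finset.sum_nonneg fun p _ => dotProduct_self_nonneg' _
  refine (hHc _).trans ?_
  have h1 : wc * ((1 + t) * (m * ∑ p, D u p ⬝ᵥ D u p)) ≤ (1 + t) * (u ⬝ᵥ (Hf *ᵥ u)) := by
    have := mul_le_mul_of_nonneg_right hw hF0
    nlinarith [hHf u, mul_le_mul_of_nonneg_left (this.trans (hHf u)) (show (0:ℝ) ≤ 1 + t by linarith)]
  have h2 : wc * ((1 + t⁻¹) * ∑ p', Eu u p' ⬝ᵥ Eu u p') ≤ (1 + t⁻¹) * wc * K * (u ⬝ᵥ u) := by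
    have := mul_le_mul_of_nonneg_left (hE u) (show (0:ℝ) ≤ wc * (1 + t⁻¹) by positivity)
    linarith [this]
  calc wc * ∑ p', D' (Q *ᵥ u) p' ⬝ᵥ D' (Q *ᵥ u) p'
      ≤ wc * ((1 + t) * (m * ∑ p, D u p ⬝ᵥ D u p) + (1 + t⁻¹) * ∑ p', Eu u p' ⬝ᵥ Eu u p') := mul_le_mul_of_nonneg_left h hwc
    _ = wc * ((1 + t) * (m * ∑ p, D u p ⬝ᵥ D u p)) + wc * ((1 + t⁻¹) * ∑ p', Eu u p' ⬝ᵥ Eu u p') := mul_add _ _ _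
    _ ≤ (1 + t) * (u ⬝ᵥ (Hf *ᵥ u)) + (1 + t⁻¹) * wc * K * (u ⬝ᵥ u) := add_le_add h1 h2

/-- **`intertwine_jensen_exact` — (STAB) WITH CONSTANT 1 FROM AN EXACT INTERTWINING IDENTITY** [our proof]: no defect ⟹ `⟨Qu, H_cQu⟩ ≤ ⟨u, H_fu⟩`. -/
theorem intertwine_jensen_exact (hq : ∀ p' p, 0 ≤ q p' p) (hq1 : ∀ p', ∑ p, q p' p ≤ 1) (hW : ∀ p' p, (W p' p)ᵀ * W p' p = 1)
    (hmult : ∀ p, ∑ p', q p' p ≤ m) (hwc : 0 ≤ wc) (hw : wc * m ≤ wf)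
    (hHf : ∀ u : X → ℝ, wf * ∑ p, D u p ⬝ᵥ D u p ≤ u ⬝ᵥ (Hf *ᵥ u))
    (hHc : ∀ v : Y → ℝ, v ⬝ᵥ (Hc *ᵥ v) ≤ wc * ∑ p', D' v p' ⬝ᵥ D' v p')
    (hint : ∀ (u : X → ℝ) p', D' (Q *ᵥ u) p' = ∑ p, q p' p • (W p' p *ᵥ D u p)) (u : X → ℝ) :
    (Q *ᵥ u) ⬝ᵥ (Hc *ᵥ (Q *ᵥ u)) ≤ u ⬝ᵥ (Hf *ᵥ u) := by
  have h := intertwine_sum_le_exact q hq hq1 W hW hmult (D u) (D' (Q *ᵥ u)) (hint u)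
  have hF0 : 0 ≤ ∑ p, D u p ⬝ᵥ D u p := Finset.sum_nonneg fun p _ => dotProduct_self_nonneg' _
  refine (hHc _).trans (le_trans ?_ (hHf u))
  calc wc * ∑ p', D' (Q *ᵥ u) p' ⬝ᵥ D' (Q *ᵥ u) p' ≤ wc * (m * ∑ p, D u p ⬝ᵥ D u p) := mul_le_mul_of_nonneg_left h hwc
    _ = (wc * m) * ∑ p, D u p ⬝ᵥ D u p := by ring
    _ ≤ wf * ∑ p, D u p ⬝ᵥ D u p := mul_le_mul_of_nonneg_right hw hF0

/-- **`posSemidef_intertwine_jensen`** — the same as PART 20's (STAB-ε,δ) shape (`G = 1`): for symmetric `H_f`, `H_c` and every `t > 0`,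
`((1 + t)•H_f + ((1 + t⁻¹)·w_c·K)•1 − QᵀH_cQ).PosSemidef`. [our proof] -/
theorem posSemidef_intertwine_jensen [DecidableEq X] (hq : ∀ p' p, 0 ≤ q p' p) (hq1 : ∀ p', ∑ p, q p' p ≤ 1)
    (hW : ∀ p' p, (W p' p)ᵀ * W p' p = 1) (hmult : ∀ p, ∑ p', q p' p ≤ m) (hwc : 0 ≤ wc) (hw : wc * m ≤ wf)
    (hHfs : Hfᵀ = Hf) (hHcs : Hcᵀ = Hc)
    (hHf : ∀ u : X → ℝ, wf * ∑ p, D u p ⬝ᵥ D u p ≤ u ⬝ᵥ (Hf *ᵥ u))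
    (hHc : ∀ v : Y → ℝ, v ⬝ᵥ (Hc *ᵥ v) ≤ wc * ∑ p', D' v p' ⬝ᵥ D' v p')
    (hint : ∀ (u : X → ℝ) p', D' (Q *ᵥ u) p' = ∑ p, q p' p • (W p' p *ᵥ D u p) + Eu u p')
    (hE : ∀ u : X → ℝ, ∑ p', Eu u p' ⬝ᵥ Eu u p' ≤ K * (u ⬝ᵥ u)) {t : ℝ} (ht : 0 < t) :
    ((1 + t) • Hf + ((1 + t⁻¹) * wc * K) • (1 : Matrix X X ℝ) - Qᵀ * Hc * Q).PosSemidef := by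
  refine PosSemidef.of_dotProduct_mulVec_nonneg ?_ fun u => ?_
  · rw [Matrix.IsHermitian, Matrix.conjTranspose_eq_transpose_of_trivial, transpose_sub, transpose_add, transpose_smul, transpose_smul,
      transpose_one, hHfs, transpose_mul, transpose_mul, transpose_transpose, hHcs, Matrix.mul_assoc]
  · simp only [star_trivial, sub_mulVec, add_mulVec, dotProduct_sub, dotProduct_add, smul_mulVec, dotProduct_smul, smul_eq_mul,
      one_mulVec, sub_nonneg]
    have e : u ⬝ᵥ ((Qᵀ * Hc * Q) *ᵥ u) = (Q *ᵥ u) ⬝ᵥ (Hc *ᵥ (Q *ᵥ u)) := by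
      rw [mulVec_dotProduct_eq, mulVec_mulVec, mulVec_mulVec, Matrix.mul_assoc]
    rw [e]
    exact intertwine_jensen hq hq1 hW hmult hwc hw hHf hHc hint hE ht u

/-- **`posSemidef_intertwine_jensen_exact`** — PART 18's (STAB) shape from an exact intertwining identity: `(H_f − QᵀH_cQ).PosSemidef`. [our proof] -/
theorem posSemidef_intertwine_jensen_exact (hq : ∀ p' p, 0 ≤ q p' p) (hq1 : ∀ p', ∑ p, q p' p ≤ 1)
    (hW : ∀ p' p, (W p' p)ᵀ * W p' p = 1) (hmult : ∀ p, ∑ p', q p' p ≤ m) (hwc : 0 ≤ wc) (hw : wc * m ≤ wf)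
    (hHfs : Hfᵀ = Hf) (hHcs : Hcᵀ = Hc)
    (hHf : ∀ u : X → ℝ, wf * ∑ p, D u p ⬝ᵥ D u p ≤ u ⬝ᵥ (Hf *ᵥ u))
    (hHc : ∀ v : Y → ℝ, v ⬝ᵥ (Hc *ᵥ v) ≤ wc * ∑ p', D' v p' ⬝ᵥ D' v p')
    (hint : ∀ (u : X → ℝ) p', D' (Q *ᵥ u) p' = ∑ p, q p' p • (W p' p *ᵥ D u p)) :
    (Hf - Qᵀ * Hc * Q).PosSemidef := by
  refine PosSemidef.of_dotProduct_mulVec_nonneg ?_ fun u => ?_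
  · rw [Matrix.IsHermitian, Matrix.conjTranspose_eq_transpose_of_trivial, transpose_sub, hHfs, transpose_mul, transpose_mul,
      transpose_transpose, hHcs, Matrix.mul_assoc]
  · simp only [star_trivial, sub_mulVec, dotProduct_sub, sub_nonneg]
    have e : u ⬝ᵥ ((Qᵀ * Hc * Q) *ᵥ u) = (Q *ᵥ u) ⬝ᵥ (Hc *ᵥ (Q *ᵥ u)) := by
      rw [mulVec_dotProduct_eq, mulVec_mulVec, mulVec_mulVec, Matrix.mul_assoc]
    rw [e]
    exact intertwine_jensen_exact hq hq1 hW hmult hwc hw hHf hHc hint u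

end Forms

end Summit.QuantumFields.BalabanUV.Beta.GAN24.DerivativeRateTransferJensenIntertwine

end
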